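import Mathlib
import Summits.AtomisticToContinuum.HydrodynamicLimit.Theorems.InformationPercolationEngineKickFairRelEquilibriumMesoLongWindowAtDefs
import Summits.AtomisticToContinuum.HydrodynamicLimit.Theorems.InformationPercolationEngineKickFairRelEquilibriumMesoBetaLGConst
import Summits.AtomisticToContinuum.HydrodynamicLimit.Theorems.InformationPercolationEngineKickFairRelEquilibriumMesoShortFlightRung0
import Summits.AtomisticToContinuum.HydrodynamicLimit.Theorems.InformationPercolationEngineKickFairRelEquilibriumMesoClosePairCountLong
import Summits.AtomisticToContinuum.HydrodynamicLimit.Theorems.InformationPercolationEngineKickFairRelEquilibriumMesoSameWindowPairCovLongConst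
import HarnessLib

/-!
# `KickFairRelEquilibriumMeso`, line `kinetic-window-cut` rev 5 — the EQUILIBRIUM INPUTS: B1, U, CPL, SWL at CONSTANT profiles

Prover file (`--supports stmt-AtomisticToContinuum-15177`, lead c8, wave 2) for the four registered stubs of the equilibrium case of the line
(`Cruxes/KickFairRelEquilibriumMeso/Lines/kinetic_window_cut.lean`, rev 5): the per-profile bodies (`…LongWindowAtDefs`, p165250) of the four
physical statements B1 (`SingleKickBiasAt`), U (`ShortFlightLGAt`), CPL (`ClosePairCountLongAt`) and SWL (`SameWindowPairCovLongAt`) at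
CONSTANT profiles `(a, θ, u)`, `a, θ > 0`, i.e. under the invariant canonical Gibbs law `G_{a,u,θ} = localGibbsLaw σ a u θ`:

* `singleKickBiasAt_const` — B1 is TRIVIAL at equilibrium: the `LG`-conditional bias `β_{i,n}` of every kick vanishes `G_{a,u,θ}`-a.e.
  (`betaLG_const_ae_eq_zero`, p156240: `κ` IS the conditional mean under the invariant law, and `dLG/dG` is a function of the past), for all
  `(i, n)` simultaneously (`ae_all_iff` over the countable index set), so the integrand `(ε/(N+1)) Σ_i Σ_{n<cnt_i} |β_{i,n}|` is `0` a.e. and its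
  mean is `0 ≤ δ` — with `σ₀ := 1/2`, `N₀ := 0`;
* `shortFlightLGAt_const` — U at constant profiles is VERBATIM the landed rung-0 computation `shortFlightLG_rung0` (p126384);
* `closePairCountLongAt_const` — CPL holds for ALL continuous positive profiles (`stub_closePairCountLong`, p164751), in particular for constants;
* `sameWindowPairCovLongAt_const_of_decorrelation` — SWL at constant profiles is `SameWindowPairCovLongConst rs` (`sameWindowPairCovLongConst_iff`,
  `Iff.rfl`), which follows from the pure decorrelation input `FarPairDecorrelationLongConst rs` (`sameWindowPairCovLongConst_of_decorrelation`,
  p163327).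

Consumed by the lead's corollary `FarPairDecorrelationLongConst rs → EquilibriumMesoBody rs` through the per-profile window cut and reduction.
-/

noncomputable section

open MeasureTheory Set Filter Topology
open scoped ENNReal Classical

namespace Summit.AtomisticToContinuum.HydrodynamicLimit.Theorems.KickFairRelEquilibriumMesoLine

open Literature.Analysis.FluidPDE Literature.MathematicalPhysics.KineticTheory

/-! ## B1 at constant profiles -/

/-- **B1 AT CONSTANT PROFILES (registered stub `singleKickBiasAt_const`).** For constants `a, θ > 0`, `u`, the body of `SingleKickBias rs` holds
with `σ₀ := 1/2` and `N₀ := 0`: for `0 < σ < 1/2`, every flow, horizon, bounded continuous `g` and `N`, the conditional biases `β_{i,n}` vanish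
`G_{a,u,θ}`-a.e. for all `(i, n) ∈ Fin (N+1) × ℕ` at once (`betaLG_const_ae_eq_zero` + `ae_all_iff`), so
`E_G[(ε/(N+1)) Σ_i Σ_{n<cnt_i} |β_{i,n}|] = 0 ≤ δ` (`lintegral_congr_ae`, `lintegral_zero`). [folklore] -/
theorem singleKickBiasAt_const : ∀ (a θ : ℝ) (u : V3), 0 < a → 0 < θ → SingleKickBiasAt rs (fun _ => a) (fun _ => θ) (fun _ => u) := by
  intro a θ u ha hθ
  refine ⟨1 / 2, by norm_num, ?_⟩
  intro σ hσ hσlt Φ τ _hτ g hg hgb δ _hδ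
  refine ⟨0, fun N _ => ?_⟩
  -- all conditional biases vanish simultaneously, a.e. under the constant-profile Gibbs law
  have hae : ∀ᵐ z ∂(localGibbsLaw σ (fun _ => a) (fun _ => u) (fun _ => θ) N (Φ N)),
      ∀ (i : Fin (N + 1)) (n : ℕ), betaLG σ (fun _ => a) (fun _ => θ) (fun _ => u) (Φ N) (rs N) g i n z = 0 :=
    ae_all_iff.2 fun i => ae_all_iff.2 fun n =>
      (betaLG_const_ae_eq_zero rs a θ u ha hθ σ hσ (hσlt.le) N (Φ N) g hg hgb i n).mono fun z hz => hz
  have h0 : (fun z => ENNReal.ofReal (hsDiameter σ N / ((N : ℝ) + 1) *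
        ∑ i : Fin (N + 1), ∑ n ∈ Finset.range (cnt (Φ N) τ z i),
          |betaLG σ (fun _ => a) (fun _ => θ) (fun _ => u) (Φ N) (rs N) g i n z|))
      =ᵐ[localGibbsLaw σ (fun _ => a) (fun _ => u) (fun _ => θ) N (Φ N)] fun _ => 0 := by
    filter_upwards [hae] with z hz
    simp [hz]
  rw [lintegral_congr_ae h0, lintegral_zero]
  exact zero_le

/-! ## U at constant profiles -/

/-- **U AT CONSTANT PROFILES (registered stub `shortFlightLGAt_const`).** The body of `ShortFlightLG` at constant profiles `a, θ > 0`, `u` is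
verbatim the landed rung-0 mean bound for the normalised short-flight collision count under the invariant Gibbs law (`shortFlightLG_rung0`,
p126384: a first-moment collision-flux computation). [folklore] -/
theorem shortFlightLGAt_const : ∀ (a θ : ℝ) (u : V3), 0 < a → 0 < θ → ShortFlightLGAt (fun _ => a) (fun _ => θ) (fun _ => u) :=
  fun a θ u ha hθ => shortFlightLG_rung0 a θ u ha hθ

/-! ## CPL at constant profiles -/

/-- **CPL AT CONSTANT PROFILES (registered stub `closePairCountLongAt_const`).** CPL holds for ALL continuous positive profiles
(`stub_closePairCountLong`, p164751: deterministic packing count on the energy-typical set plus the exponential `LG` energy tail); constant positive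
profiles are continuous positive profiles (`closePairCountLong_iff_forall_at`). [folklore] -/
theorem closePairCountLongAt_const : ∀ (a θ : ℝ) (u : V3), 0 < a → 0 < θ → ClosePairCountLongAt rs (fun _ => a) (fun _ => θ) (fun _ => u) :=
  fun a θ u ha hθ => (closePairCountLong_iff_forall_at rs).1 stub_closePairCountLong (fun _ => a) (fun _ => θ) (fun _ => u)
    continuous_const continuous_const continuous_const (fun _ => ha) (fun _ => hθ)

/-! ## SWL at constant profiles from pure decorrelation -/

/-- **SWL AT CONSTANT PROFILES FROM PURE DECORRELATION (registered stub `sameWindowPairCovLongAt_const_of_decorrelation`).** Under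
`FarPairDecorrelationLongConst rs` (far same-window pairs of long-flight kicks have small excess conditional covariance `(|Γ| − η)₊` in
`N^{1/3}`-normalised pair-Campbell mean under the invariant law), SWL holds at every constant profile: `sameWindowPairCovLongConst_of_decorrelation`
(p163327: the number of long same-window pairs is deterministic, `≤ W (A+1)² (N+1)²`) gives `SameWindowPairCovLongConst rs`, which IS the family of
per-profile bodies `SameWindowPairCovLongAt rs a θ u` over constants (`sameWindowPairCovLongConst_iff`). [folklore] -/
theorem sameWindowPairCovLongAt_const_of_decorrelation : FarPairDecorrelationLongConst rs → ∀ (a θ : ℝ) (u : V3), 0 < a → 0 < θ → SameWindowPairCovLongAt rs (fun _ => a) (fun _ => θ) (fun _ => u) :=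
  fun hD => (sameWindowPairCovLongConst_iff rs).1 (sameWindowPairCovLongConst_of_decorrelation hD)

end Summit.AtomisticToContinuum.HydrodynamicLimit.Theorems.KickFairRelEquilibriumMesoLine

end
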